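import Mathlib.RingTheory.MvPowerSeries.Inverse
import Mathlib.RingTheory.MvPowerSeries.NoZeroDivisors
import Mathlib.RingTheory.Ideal.Quotient.Operations
import Mathlib.RingTheory.LocalRing.RingHom.Basic
import Mathlib.RingTheory.DiscreteValuationRing.Basic
import Mathlib.Algebra.GroupWithZero.NonZeroDivisors
import Mathlib.Tactic.LinearCombination
import Mathlib.Tactic.Ring
import Literature.AlgebraicGeometry.Resolution.RegularLocalRingsQuotient
import HarnessLib

/-!
# T-NOCART / T-MRESCUE — ring-level pieces of the DILEMMA-point analysis (LEAD-MEMO-2 §1, §2, §4)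

[OURS · L1 W4.5(b)] Helper for the research stub `stub_elnat_three_isolated` of the crux `EquisingularLiftNat`
(stmt-ResolutionOfSingularities-20038; route `EquisingularLift`, chain w45b; res-L1-w45b-lead-2 LEAD-MEMO-2 §4
«TYPED TARGETS», NAMING 2026-08-27T06:32:06Z «T-NOCART + T-MRESCUE in ONE file»). NOT a statement of any
manuscript; AI-written kernel lemmas of the cell `res-hironaka` (weaker than expert review). Typed by res-type-004.

**T-NOCART** («a regular `O`-curve with a section through `q` has regular special fibre at `q`»; LEAD-MEMO-2 §1:
a section of `D → Spec O` through a closed point `q` of `D_k` is an `O`-algebra retraction `𝒪_{D,q} → O`).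
* `isLocalHom_of_retraction`, `mem_maximalIdeal_of_retraction` — a ring retraction `π : S → R` (`π ∘ ι = id`) of a
  LOCAL ring onto a non-trivial ring is automatically a local hom (it is surjective), and `ι(𝔪_R) ⊆ 𝔪_S`;
* `map_maximalIdeal_pow_le`, `notMem_maximalIdeal_sq_of_map`, `notMem_maximalIdeal_sq_of_retraction` (T-NOCART
  (i)) — `π(𝔪_S^n) ⊆ 𝔪_R^n`, hence `x ∉ 𝔪_R² ⇒ ι x ∉ 𝔪_S²`;
* `algebraMap_mem_maximalIdeal`, `algebraMap_notMem_maximalIdeal_sq`, `isRegularLocalRing_quotient_of_section`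
  (T-NOCART (ii)) — `O` local, `ϖ ∈ 𝔪_O ∖ 𝔪_O²`, `S` a REGULAR local `O`-algebra with an `O`-algebra retraction
  `S →ₐ[O] O`: `ϖ·1 ∈ 𝔪_S ∖ 𝔪_S²`, so `S ⧸ ϖS` is regular local of dimension `dim S − 1` (tree
  `Literature.AlgebraicGeometry.Resolution.IsRegularLocalRing.quotient_span_singleton`, Matsumura Thm. 14.2);
* `uniformizer_mem_and_notMem_sq`, `isRegularLocalRing_quotient_of_section_of_irreducible`,
  `isEmpty_algHom_of_not_isRegularLocalRing` — the DVR case and the contrapositive «no section through a point where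
  the special fibre is not regular» (LEAD-MEMO-2 §1 by-product).

**T-MRESCUE** («on `ab = x³`: `(a, x)` is not principal, `(a, x³) = (a)` is»; LEAD-MEMO-2 §2: on the `A₂` point
`{ab = x³}` the trace `(a, x³)·𝒪 = (a)` is USELESS = invertible, the trace `(a, x)·𝒪` of the sheet-tangent ramified
triple centre `C_M` — the prime of the non-Cartier line `L = {a = x = 0}` — is USEFUL = not invertible).
* `span_pair_eq_span_singleton_of_mul_eq` — any commutative ring: `a * b = x ^ 3 ⇒ (a, x³) = (a)`;
* `isPrincipal_span_pair_iff_dvd_or_dvd` — LOCAL ring: `(u, v)` is principal iff `u ∣ v ∨ v ∣ u` (elementary);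
  `not_isPrincipal_span_pair_of_not_dvd`;
* the model `A = k[[x,a,b]]/(ab − x³) = MvPowerSeries (Fin 3) k ⧸ (X 1 * X 2 − X 0 ^ 3)` (`x = X 0`, `a = X 1`,
  `b = X 2`; `k` any field): `model_isLocalRing`, `model_mul_eq_pow`, `model_not_dvd_left/right` (coefficient
  tests in `k[[x,a,b]]` at the monomials `x`, `a`), **`model_not_isPrincipal`** (`(ā, x̄)` NOT principal), **`model_span_pair_eq`**
  (`(ā, x̄³) = (ā)`), `mem_span_of_X_one_mul_mem` / **`model_mem_nonZeroDivisors`** (`ā` is a non-zero-divisor of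
  `A`: the USELESS trace `(ā)` is an invertible ideal) — in particular `ā, x̄ ≠ 0`.

No definitions (rings and generators are spelled out in each statement). References: folklore commutative algebra;
Matsumura, *Commutative Ring Theory*, Thm. 14.2 (through the tree file); LEAD-MEMO-2 (cell-internal, OURS).
-/

-- single-problem summit: the doubled namespace component `ResolutionOfSingularities` is forced
set_option linter.dupNamespace false

namespace Summit.ResolutionOfSingularities.ResolutionOfSingularities.Cruxes.EquisingularLiftNat.Sections.DilemmaLocal

open IsLocalRing

/-! ### T-NOCART, ring-retraction form -/

section Retraction

variable {R S : Type*} [CommRing R] [CommRing S]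

/-- A ring retraction `π : S →+* R` (`π (ι r) = r` for a ring map `ι : R →+* S`) of a LOCAL ring `S` onto a
non-trivial ring `R` is a local homomorphism: it is surjective, and a surjection out of a local ring reflects units.
(So the hypothesis «the retraction is a local hom» of the NAMING is automatic.) [folklore] -/
theorem isLocalHom_of_retraction [IsLocalRing S] [Nontrivial R] (ι : R →+* S) (π : S →+* R)
    (h : ∀ r, π (ι r) = r) : IsLocalHom π :=
  IsLocalHom.of_surjective π fun r => ⟨ι r, h r⟩

/-- For a ring retraction `π ∘ ι = id` with `S` local: `ι` maps non-units of `R` to non-units of `S` — if `ι x`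
were a unit, so would be `x = π (ι x)`. In particular `ι(𝔪_R) ⊆ 𝔪_S` (no locality of `ι` assumed). [folklore] -/
theorem mem_maximalIdeal_of_retraction [IsLocalRing R] [IsLocalRing S] (ι : R →+* S) (π : S →+* R)
    (h : ∀ r, π (ι r) = r) {x : R} (hx : x ∈ maximalIdeal R) : ι x ∈ maximalIdeal S := by
  intro hu
  apply hx
  have := hu.map π
  rwa [h] at this

variable [IsLocalRing R] [IsLocalRing S]

/-- A local homomorphism `π : S →+* R` of local rings maps `𝔪_S ^ n` into `𝔪_R ^ n`. [folklore] -/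
theorem map_maximalIdeal_pow_le (π : S →+* R) [IsLocalHom π] (n : ℕ) :
    ((maximalIdeal S) ^ n).map π ≤ (maximalIdeal R) ^ n := by
  rw [Ideal.map_pow]
  exact Ideal.pow_right_mono (IsLocalRing.map_maximalIdeal_le π) n

/-- **T-NOCART (i), local-hom form.** If `π : S →+* R` is a local homomorphism of local rings and
`π s ∉ 𝔪_R²`, then `s ∉ 𝔪_S²` («the retraction maps `𝔪_S²` into `𝔪_R²`»). [folklore] -/
theorem notMem_maximalIdeal_sq_of_map (π : S →+* R) [IsLocalHom π] {s : S}
    (hs : π s ∉ (maximalIdeal R) ^ 2) : s ∉ (maximalIdeal S) ^ 2 := fun h =>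
  hs (map_maximalIdeal_pow_le π 2 (Ideal.mem_map_of_mem π h))

/-- **T-NOCART (i), retraction form (LEAD-MEMO-2 §4 / NAMING (i)).** Local rings `R`, `S`, ring maps
`ι : R →+* S`, `π : S →+* R` with `π ∘ ι = id`. If `x ∉ 𝔪_R²` then `ι x ∉ 𝔪_S²`. (Neither `ι` nor `π` needs to be
assumed local: `π` is local by `isLocalHom_of_retraction`.) [folklore] -/
theorem notMem_maximalIdeal_sq_of_retraction (ι : R →+* S) (π : S →+* R) (h : ∀ r, π (ι r) = r)
    {x : R} (hx : x ∉ (maximalIdeal R) ^ 2) : ι x ∉ (maximalIdeal S) ^ 2 := by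
  haveI := isLocalHom_of_retraction ι π h
  exact notMem_maximalIdeal_sq_of_map π (by rwa [h])

end Retraction

/-! ### T-NOCART, `O`-algebra form («a section through the point») -/

section Section

variable {O S : Type*} [CommRing O] [CommRing S] [IsLocalRing O] [IsLocalRing S] [Algebra O S]

/-- With an `O`-algebra retraction `π : S →ₐ[O] O` of local rings («a section of `Spec S → Spec O` through the
closed point»; `π` is a local hom by `isLocalHom_of_retraction`): the structure map sends `𝔪_O` into `𝔪_S`.
[folklore] -/
theorem algebraMap_mem_maximalIdeal (π : S →ₐ[O] O) {ϖ : O} (hϖ : ϖ ∈ maximalIdeal O) :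
    algebraMap O S ϖ ∈ maximalIdeal S :=
  mem_maximalIdeal_of_retraction (algebraMap O S) π.toRingHom (fun r => by simp) hϖ

/-- **T-NOCART (ii), first half.** With an `O`-algebra retraction `S →ₐ[O] O` of local rings: if `ϖ ∉ 𝔪_O²`
then `ϖ · 1_S ∉ 𝔪_S²`. [folklore] -/
theorem algebraMap_notMem_maximalIdeal_sq (π : S →ₐ[O] O) {ϖ : O} (hϖ : ϖ ∉ (maximalIdeal O) ^ 2) :
    algebraMap O S ϖ ∉ (maximalIdeal S) ^ 2 :=
  notMem_maximalIdeal_sq_of_retraction (algebraMap O S) π.toRingHom (fun r => by simp) hϖ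

omit [IsLocalRing S] in
/-- **T-NOCART (ii) (LEAD-MEMO-2 §4 / NAMING (ii)).** Let `O` be a local ring, `ϖ ∈ 𝔪_O ∖ 𝔪_O²` (e.g. a
uniformizer of a DVR), and `S` a REGULAR local `O`-algebra admitting an `O`-algebra retraction `π : S →ₐ[O] O`
(«a section through the point»). Then `S ⧸ ϖS` is a regular local ring and `dim S⧸ϖS + 1 = dim S` — «a regular
`O`-curve with a section through `q` has regular special fibre at `q`». Via the tree's Matsumura Thm. 14.2
(`IsRegularLocalRing.quotient_span_singleton`, Matsumura Thm. 14.2). [folklore] -/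
theorem isRegularLocalRing_quotient_of_section [IsRegularLocalRing S] (π : S →ₐ[O] O) {ϖ : O}
    (hϖ : ϖ ∈ maximalIdeal O) (hϖ2 : ϖ ∉ (maximalIdeal O) ^ 2) :
    IsRegularLocalRing (S ⧸ Ideal.span {algebraMap O S ϖ}) ∧
      ringKrullDim (S ⧸ Ideal.span {algebraMap O S ϖ}) + 1 = ringKrullDim S :=
  Literature.AlgebraicGeometry.Resolution.IsRegularLocalRing.quotient_span_singleton
    (algebraMap_mem_maximalIdeal π hϖ) (algebraMap_notMem_maximalIdeal_sq π hϖ2)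

end Section

/-! ### T-NOCART over a DVR and the contrapositive «no section through a singular point of the special fibre» -/

section DVR

variable {O S : Type*} [CommRing O] [IsDomain O] [IsDiscreteValuationRing O] [CommRing S] [Algebra O S]

/-- A uniformizer `ϖ` of a DVR lies in `𝔪 ∖ 𝔪²` (`𝔪 = (ϖ)`, and `ϖ ∈ (ϖ²)` would make `ϖ` a unit). [folklore] -/
theorem uniformizer_mem_and_notMem_sq {ϖ : O} (hϖ : Irreducible ϖ) :
    ϖ ∈ maximalIdeal O ∧ ϖ ∉ (maximalIdeal O) ^ 2 := by
  have hmax : maximalIdeal O = Ideal.span {ϖ} := hϖ.maximalIdeal_eq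
  refine ⟨by rw [hmax]; exact Ideal.mem_span_singleton_self ϖ, fun h => ?_⟩
  rw [hmax, Ideal.span_singleton_pow, Ideal.mem_span_singleton] at h
  obtain ⟨c, hc⟩ := h
  apply hϖ.not_isUnit
  refine IsUnit.of_mul_eq_one c (mul_left_cancel₀ hϖ.ne_zero ?_)
  rw [mul_one, ← mul_assoc, ← pow_two]
  exact hc.symm

/-- **T-NOCART over a DVR.** `O` a DVR with uniformizer `ϖ`, `S` a regular local `O`-algebra with an `O`-algebra
retraction `S →ₐ[O] O` («a section through the point `q`»): the special fibre `S ⧸ ϖS` is regular local at `q`.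
[folklore] -/
theorem isRegularLocalRing_quotient_of_section_of_irreducible [IsRegularLocalRing S] (π : S →ₐ[O] O) {ϖ : O}
    (hϖ : Irreducible ϖ) : IsRegularLocalRing (S ⧸ Ideal.span {algebraMap O S ϖ}) :=
  (isRegularLocalRing_quotient_of_section π (uniformizer_mem_and_notMem_sq hϖ).1
    (uniformizer_mem_and_notMem_sq hϖ).2).1

/-- **T-NOCART, contrapositive (LEAD-MEMO-2 §1 «no section through a singular point of `D_k`»).** `O` a DVR with
uniformizer `ϖ`, `S` a regular local `O`-algebra whose special fibre `S ⧸ ϖS` is NOT a regular local ring: there is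
no `O`-algebra retraction `S →ₐ[O] O`. Reading: a regular `O`-model `D` of a curve `Γ = D_k` admits no section
through a singular point of `Γ`. [folklore] -/
theorem isEmpty_algHom_of_not_isRegularLocalRing [IsRegularLocalRing S] {ϖ : O} (hϖ : Irreducible ϖ)
    (h : ¬ IsRegularLocalRing (S ⧸ Ideal.span {algebraMap O S ϖ})) : IsEmpty (S →ₐ[O] O) :=
  ⟨fun π => h (isRegularLocalRing_quotient_of_section_of_irreducible π hϖ)⟩

end DVR

/-! ### T-MRESCUE, abstract part: two-generated ideals of a local ring -/

section TwoGenerated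

variable {A : Type*} [CommRing A]

/-- **T-MRESCUE, the USELESS trace (any commutative ring).** If `a * b = x ^ 3` then `(a, x³) = (a)`: on the
`A₂` point `{ab = x³}` the trace ideal `(a, x³)·𝒪` of LEAD-MEMO-2 §2 is principal. [folklore] -/
theorem span_pair_eq_span_singleton_of_mul_eq {a b x : A} (h : a * b = x ^ 3) :
    Ideal.span {a, x ^ 3} = Ideal.span {a} :=
  Ideal.span_pair_eq_span_left_iff_dvd.mpr ⟨b, h.symm⟩

variable [IsLocalRing A]

/-- **Two-generated ideals of a LOCAL ring.** `(u, v)` is principal iff `u ∣ v` or `v ∣ u` (i.e. iff one generator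
is redundant). Proof without Nakayama: if `(u, v) = (f)`, `f = αu + βv`, `u = γf`, `v = δf`, then
`(1 − αγ − βδ) f = 0`; either `1 − αγ − βδ` is a unit (then `f = 0 = u = v`) or `αγ + βδ` is, and then `γ` or `δ`
is a unit (local ring). Locality is necessary (`k × k`, `u = (1,0)`, `v = (0,1)`). [folklore] -/
theorem isPrincipal_span_pair_iff_dvd_or_dvd (u v : A) :
    (Ideal.span {u, v}).IsPrincipal ↔ u ∣ v ∨ v ∣ u := by
  constructor
  · intro hP
    set I : Ideal A := Ideal.span {u, v} with hI
    set f : A := Submodule.IsPrincipal.generator I with hf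
    have hIf : I = Ideal.span {f} := (Ideal.span_singleton_generator I).symm
    have hfI : f ∈ I := by rw [hIf]; exact Ideal.mem_span_singleton_self f
    have huI : u ∈ Ideal.span {f} := by rw [← hIf]; exact Ideal.subset_span (by simp)
    have hvI : v ∈ Ideal.span {f} := by rw [← hIf]; exact Ideal.subset_span (by simp)
    obtain ⟨α, β, hαβ⟩ := Ideal.mem_span_pair.1 hfI
    obtain ⟨γ, hγ⟩ := Ideal.mem_span_singleton'.1 huI
    obtain ⟨δ, hδ⟩ := Ideal.mem_span_singleton'.1 hvI
    -- `(1 - (αγ + βδ)) f = 0`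
    have key : (1 - (α * γ + β * δ)) * f = 0 := by
      linear_combination (-1 : A) * hαβ - α * hγ - β * hδ
    rcases IsLocalRing.isUnit_or_isUnit_one_sub_self (α * γ + β * δ) with hu | hu
    · rcases IsLocalRing.isUnit_or_isUnit_of_isUnit_add hu with hu' | hu'
      · -- `γ` is a unit: `f = γ⁻¹ u`, so `v = δ γ⁻¹ u`
        obtain ⟨γu, hγu⟩ := isUnit_of_mul_isUnit_right hu'
        refine Or.inl ⟨δ * ↑γu⁻¹, ?_⟩
        have hf' : f = ↑γu⁻¹ * u := by rw [← hγ, ← hγu, ← mul_assoc, Units.inv_mul, one_mul]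
        rw [← hδ, hf']
        ring
      · -- `δ` is a unit: `f = δ⁻¹ v`, so `u = γ δ⁻¹ v`
        obtain ⟨δu, hδu⟩ := isUnit_of_mul_isUnit_right hu'
        refine Or.inr ⟨γ * ↑δu⁻¹, ?_⟩
        have hf' : f = ↑δu⁻¹ * v := by rw [← hδ, ← hδu, ← mul_assoc, Units.inv_mul, one_mul]
        rw [← hγ, hf']
        ring
    · -- `1 - (αγ + βδ)` is a unit: `f = 0`, hence `u = v = 0`
      have hf0 : f = 0 := (hu.mul_right_eq_zero).mp key
      refine Or.inl ⟨0, ?_⟩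
      rw [← hδ, hf0, mul_zero, mul_zero]
  · rintro (h | h)
    · exact ⟨⟨u, by rw [Ideal.span_pair_eq_span_left_iff_dvd.mpr h, Ideal.submodule_span_eq]⟩⟩
    · exact ⟨⟨v, by rw [Ideal.span_pair_eq_span_right_iff_dvd.mpr h, Ideal.submodule_span_eq]⟩⟩

/-- **T-MRESCUE, the USEFUL trace (abstract form).** In a local ring, if `a ∤ x` and `x ∤ a` then `(a, x)` is
not principal (hence not invertible). On `{ab = x³}` this is the trace `(a, x)·𝒪` of the sheet-tangent ramified
triple structure `C_M` of LEAD-MEMO-2 §2 — the prime of the non-Cartier line `L`. [folklore] -/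
theorem not_isPrincipal_span_pair_of_not_dvd {a x : A} (h₁ : ¬ a ∣ x) (h₂ : ¬ x ∣ a) :
    ¬ (Ideal.span {a, x}).IsPrincipal := fun h =>
  ((isPrincipal_span_pair_iff_dvd_or_dvd a x).mp h).elim h₁ h₂

end TwoGenerated

/-! ### T-MRESCUE in the model `A = k[[x,a,b]]/(ab − x³)` -/

section Model

open MvPowerSeries

variable (k : Type*) [Field k]

/-- In `k[[x,a,b]]`: `a · f ∈ (ab − x³) ⇒ f ∈ (ab − x³)` (`a` is regular modulo the relation). Proof: if
`g·(ab − x³) = a f` then every coefficient of `g` at a monomial free of `a` vanishes (compare the coefficients of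
that monomial times `x³`), so `a ∣ g`, and `k[[x,a,b]]` has no zero-divisors. [folklore] -/
theorem mem_span_of_X_one_mul_mem (f : MvPowerSeries (Fin 3) k)
    (h : X 1 * f ∈ Ideal.span {(X 1 : MvPowerSeries (Fin 3) k) * X 2 - X 0 ^ 3}) :
    f ∈ Ideal.span {(X 1 : MvPowerSeries (Fin 3) k) * X 2 - X 0 ^ 3} := by
  classical
  obtain ⟨g, hg⟩ := Ideal.mem_span_singleton'.1 h
  -- `a ∣ g`
  have hdvd : (X 1 : MvPowerSeries (Fin 3) k) ∣ g := by
    refine X_dvd_iff.2 fun m hm => ?_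
    have e := congrArg (coeff (m + Finsupp.single (0 : Fin 3) 3)) hg
    have h1 : coeff (m + Finsupp.single (0 : Fin 3) 3) (X 1 * f : MvPowerSeries (Fin 3) k) = 0 :=
      X_dvd_iff.1 (dvd_mul_right _ _) _ (by simp [hm])
    have h2 : coeff (m + Finsupp.single (0 : Fin 3) 3) (g * (X 1 * X 2) : MvPowerSeries (Fin 3) k) = 0 :=
      X_dvd_iff.1 (show (X 1 : MvPowerSeries (Fin 3) k) ∣ g * (X 1 * X 2) from ⟨g * X 2, by ring⟩) _
        (by simp [hm])
    have h3 : coeff (m + Finsupp.single (0 : Fin 3) 3) (g * X 0 ^ 3 : MvPowerSeries (Fin 3) k) =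
        coeff m g := by
      rw [X_pow_eq, coeff_add_mul_monomial, mul_one]
    rw [mul_sub, map_sub, h1, h2, h3, zero_sub, neg_eq_zero] at e
    exact e
  obtain ⟨g', rfl⟩ := hdvd
  refine Ideal.mem_span_singleton'.2 ⟨g', ?_⟩
  have hX : (X 1 : MvPowerSeries (Fin 3) k) ≠ 0 := fun h0 => by
    simpa using congrArg (coeff (Finsupp.single (1 : Fin 3) 1)) h0
  refine mul_left_cancel₀ hX ?_
  rw [← hg, mul_assoc]

/-- The model `A = k[[x,a,b]]/(ab − x³)` is a non-trivial ring (`ab − x³` has zero constant coefficient, so it is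
not a unit of `k[[x,a,b]]`). [folklore] -/
theorem model_nontrivial :
    Nontrivial (MvPowerSeries (Fin 3) k ⧸
      Ideal.span {(X 1 : MvPowerSeries (Fin 3) k) * X 2 - X 0 ^ 3}) := by
  refine Ideal.Quotient.nontrivial_iff.2 ?_
  rw [Ne, Ideal.span_singleton_eq_top, MvPowerSeries.isUnit_iff_constantCoeff]
  simp

/-- The model `A = k[[x,a,b]]/(ab − x³)` is a LOCAL ring (quotient of the local ring `k[[x,a,b]]`): the complete
local ring of the `A₂` surface point `S₊` of LEAD-MEMO-2 §2 (up to the change of coordinates made there).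
[folklore] -/
theorem model_isLocalRing :
    IsLocalRing (MvPowerSeries (Fin 3) k ⧸
      Ideal.span {(X 1 : MvPowerSeries (Fin 3) k) * X 2 - X 0 ^ 3}) := by
  haveI := model_nontrivial k
  exact IsLocalRing.of_surjective' (Ideal.Quotient.mk _) Ideal.Quotient.mk_surjective

/-- In the model `A`: the relation `ā · b̄ = x̄ ^ 3`. [folklore] -/
theorem model_mul_eq_pow :
    Ideal.Quotient.mk (Ideal.span {(X 1 : MvPowerSeries (Fin 3) k) * X 2 - X 0 ^ 3}) (X 1) *
        Ideal.Quotient.mk (Ideal.span {(X 1 : MvPowerSeries (Fin 3) k) * X 2 - X 0 ^ 3}) (X 2) =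
      Ideal.Quotient.mk (Ideal.span {(X 1 : MvPowerSeries (Fin 3) k) * X 2 - X 0 ^ 3}) (X 0) ^ 3 := by
  rw [← map_mul, ← map_pow, Ideal.Quotient.eq]
  exact Ideal.mem_span_singleton_self _

/-- In the model `A = k[[x,a,b]]/(ab − x³)`: `ā ∤ x̄` (in particular `x̄ ≠ 0`). Coefficient test in `k[[x,a,b]]`:
if `d·(ab − x³) = x − a·c` then comparing the coefficients of the monomial `x` gives `0 = 1`. [folklore] -/
theorem model_not_dvd_left :
    ¬ Ideal.Quotient.mk (Ideal.span {(X 1 : MvPowerSeries (Fin 3) k) * X 2 - X 0 ^ 3}) (X 1) ∣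
        Ideal.Quotient.mk (Ideal.span {(X 1 : MvPowerSeries (Fin 3) k) * X 2 - X 0 ^ 3}) (X 0) := by
  classical
  rintro ⟨c, hc⟩
  obtain ⟨c, rfl⟩ := Ideal.Quotient.mk_surjective c
  rw [← map_mul, Ideal.Quotient.eq] at hc
  obtain ⟨d, hd⟩ := Ideal.mem_span_singleton'.1 hc
  have e := congrArg (coeff (Finsupp.single (0 : Fin 3) 1)) hd
  have h1 : coeff (Finsupp.single (0 : Fin 3) 1) (X 1 * c : MvPowerSeries (Fin 3) k) = 0 :=
    X_dvd_iff.1 (dvd_mul_right _ _) _ (by simp)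
  have h2 : coeff (Finsupp.single (0 : Fin 3) 1) (d * (X 1 * X 2) : MvPowerSeries (Fin 3) k) = 0 :=
    X_dvd_iff.1 (show (X 1 : MvPowerSeries (Fin 3) k) ∣ d * (X 1 * X 2) from ⟨d * X 2, by ring⟩) _
      (by simp)
  have h3 : coeff (Finsupp.single (0 : Fin 3) 1) (d * X 0 ^ 3 : MvPowerSeries (Fin 3) k) = 0 :=
    X_pow_dvd_iff.1 (dvd_mul_left _ _) _ (by simp)
  rw [mul_sub, map_sub, map_sub, h1, h2, h3, coeff_index_single_self_X] at e
  simp at e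

/-- In the model `A = k[[x,a,b]]/(ab − x³)`: `x̄ ∤ ā` (in particular `ā ≠ 0`). Coefficient test in `k[[x,a,b]]`:
if `d·(ab − x³) = a − x·c` then comparing the coefficients of the monomial `a` gives `0 = 1`. [folklore] -/
theorem model_not_dvd_right :
    ¬ Ideal.Quotient.mk (Ideal.span {(X 1 : MvPowerSeries (Fin 3) k) * X 2 - X 0 ^ 3}) (X 0) ∣
        Ideal.Quotient.mk (Ideal.span {(X 1 : MvPowerSeries (Fin 3) k) * X 2 - X 0 ^ 3}) (X 1) := by
  classical
  rintro ⟨c, hc⟩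
  obtain ⟨c, rfl⟩ := Ideal.Quotient.mk_surjective c
  rw [← map_mul, Ideal.Quotient.eq] at hc
  obtain ⟨d, hd⟩ := Ideal.mem_span_singleton'.1 hc
  have e := congrArg (coeff (Finsupp.single (1 : Fin 3) 1)) hd
  have h1 : coeff (Finsupp.single (1 : Fin 3) 1) (X 0 * c : MvPowerSeries (Fin 3) k) = 0 :=
    X_dvd_iff.1 (dvd_mul_right _ _) _ (by simp)
  have h2 : coeff (Finsupp.single (1 : Fin 3) 1) (d * (X 1 * X 2) : MvPowerSeries (Fin 3) k) = 0 :=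
    X_dvd_iff.1 (show (X 2 : MvPowerSeries (Fin 3) k) ∣ d * (X 1 * X 2) from ⟨d * X 1, by ring⟩) _
      (by simp)
  have h3 : coeff (Finsupp.single (1 : Fin 3) 1) (d * X 0 ^ 3 : MvPowerSeries (Fin 3) k) = 0 :=
    X_dvd_iff.1 (show (X 0 : MvPowerSeries (Fin 3) k) ∣ d * X 0 ^ 3 from ⟨d * X 0 ^ 2, by ring⟩) _
      (by simp)
  rw [mul_sub, map_sub, map_sub, h1, h2, h3, coeff_index_single_self_X] at e
  simp at e

/-- **T-MRESCUE in the model, USEFUL half (LEAD-MEMO-2 §2 / §4).** In `A = k[[x,a,b]]/(ab − x³)` the ideal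
`(ā, x̄)` — the prime of the line `L = {a = x = 0}` on the `A₂` point, trace of the sheet-tangent ramified triple
centre `C_M` — is NOT principal (hence not invertible: blowing it up changes the surface). [folklore] -/
theorem model_not_isPrincipal :
    ¬ (Ideal.span
        {Ideal.Quotient.mk (Ideal.span {(X 1 : MvPowerSeries (Fin 3) k) * X 2 - X 0 ^ 3}) (X 1),
          Ideal.Quotient.mk (Ideal.span {(X 1 : MvPowerSeries (Fin 3) k) * X 2 - X 0 ^ 3})
            (X 0)}).IsPrincipal := by
  haveI := model_isLocalRing k
  exact not_isPrincipal_span_pair_of_not_dvd (model_not_dvd_left k) (model_not_dvd_right k)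

/-- **T-MRESCUE in the model, USELESS half (LEAD-MEMO-2 §2 / §4).** In `A = k[[x,a,b]]/(ab − x³)`:
`(ā, x̄³) = (ā)` is principal. [folklore] -/
theorem model_span_pair_eq :
    Ideal.span
        {Ideal.Quotient.mk (Ideal.span {(X 1 : MvPowerSeries (Fin 3) k) * X 2 - X 0 ^ 3}) (X 1),
          Ideal.Quotient.mk (Ideal.span {(X 1 : MvPowerSeries (Fin 3) k) * X 2 - X 0 ^ 3}) (X 0) ^ 3} =
      Ideal.span
        {Ideal.Quotient.mk (Ideal.span {(X 1 : MvPowerSeries (Fin 3) k) * X 2 - X 0 ^ 3}) (X 1)} :=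
  span_pair_eq_span_singleton_of_mul_eq (model_mul_eq_pow k)

/-- **T-MRESCUE in the model: the USELESS trace is invertible.** In `A = k[[x,a,b]]/(ab − x³)` the element `ā`
is a non-zero-divisor, so the principal ideal `(ā) = (ā, x̄³)` is an invertible ideal (its blow-up is an
isomorphism). [folklore] -/
theorem model_mem_nonZeroDivisors :
    Ideal.Quotient.mk (Ideal.span {(X 1 : MvPowerSeries (Fin 3) k) * X 2 - X 0 ^ 3}) (X 1) ∈
      nonZeroDivisors (MvPowerSeries (Fin 3) k ⧸
        Ideal.span {(X 1 : MvPowerSeries (Fin 3) k) * X 2 - X 0 ^ 3}) := by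
  refine mem_nonZeroDivisors_iff_right.2 fun y hy => ?_
  obtain ⟨y, rfl⟩ := Ideal.Quotient.mk_surjective y
  rw [← map_mul, Ideal.Quotient.eq_zero_iff_mem] at hy
  rw [Ideal.Quotient.eq_zero_iff_mem]
  exact mem_span_of_X_one_mul_mem k y (by rwa [mul_comm y (X 1 : MvPowerSeries (Fin 3) k)] at hy)

end Model

end Summit.ResolutionOfSingularities.ResolutionOfSingularities.Cruxes.EquisingularLiftNat.Sections.DilemmaLocal
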